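import Summits.BirchSwinnertonDyer.BirchSwinnertonDyer.Theorems.ByReductionTypeAtTwoKatoFreeSandwichTransport
import Summits.BirchSwinnertonDyer.Rank1Residual.X12.InertCoreEveryCurve
import Summits.BirchSwinnertonDyer.Rank1Residual.X12.CMIsogenyInvariance
import Literature.NumberTheory.EllipticCurves.IsogenyRealPeriodProofs
import Literature.NumberTheory.EllipticCurves.IsogenyRationalPointsBaseChangeProofs
import Literature.NumberTheory.EllipticCurves.ComplexMultiplicationBurungaleFlachProofs
import Literature.NumberTheory.EllipticCurves.ComplexMultiplicationLFunctionIsogenyHoldsProofs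
import HarnessLib

/-!
# Route `ByReductionTypeAtTwo` (K4), crux `OrdMissingLowerBoundAtTwo` (stmt-BirchSwinnertonDyer-19577), line
# `kato-free-lower-sandwich-two` — the research stub RE-CENTRED AT THE OPTIMAL CURVE (`--supports`, helper)

Cell `bsd-2adic`, lead `cruxlead-stmt-BirchSwinnertonDyer-19577` (g0).  THEOREMS ONLY — no definition, no named fact, no
`sorry`.  HONEST FRAMING: the crux 19577 is NOT closed here and its research stub `stub_analyticMuLEAtMaxPeriod` (skeleton v5)
is NOT proved here; BSD is not proved by any of this.

WHAT.
* §1 `exists_rat_pos_realPeriodRat_eq_mul_of_isIsogenous` — UNCONDITIONAL rationality of the real-period ratio inside a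
  ℚ-isogeny class: `W ∼ W'` elliptic ⇒ `Ω(W') = q·Ω(W)` for some rational `q > 0` (Milne's archimedean isogeny formula
  `#ker(ψ_ℂ|W(ℝ))·Ω(W') = [W'(ℝ):ψ_ℂ W(ℝ)]·|k|·Ω(W)`, `k ∈ ℚ`, tree theorem
  `Isogeny.exists_algebraMap_card_ker_inf_realPoints_mul_realPeriod_eq`; the kernel count is finite and `≥ 1`).
* §2 `analyticMuLE_two_of_isIsogenous_of_le` — the GENERAL `μ`-transport of the certificate: `W ∼ W'` globally minimal, good
  ordinary at `2`, `Ω(W') = r·Ω(W)`, `m ≤ m' + v₂(r)` ⇒ `AnalyticMuLE W 2 m → AnalyticMuLE W' 2 m'` (`ϖ = r·ϖ'`,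
  `‖r⁻¹‖₂ = 2^{v₂ r}`).  (`…KatoFreeSandwichTransport` has the case `m = m' = 0`, `v₂ r ≥ 0`.)
* §3 THE RESEARCH STUB AT THE OPTIMAL CURVE.  Modularity in the form `exists_isNewformOf` puts an `X₀(N)`-OPTIMAL member `E₀`
  (lattice-optimal parametrisation datum at level `N_{E₀} = N_W`; tree theorem `X12.exists_isIsogenous_optimal`) in every class,
  and §1–§2 make the registered stub — «`AnalyticMuLE W″ 2 0` at the member `W″` of 2-adically MAXIMAL real period» — EQUIVALENT
  to the «TOWER-HEIGHT BOUND» at `E₀`: «`AnalyticMuLE E₀ 2 t`, where `2^t ∥ Ω(W″)/Ω(E₀)` is the height of the 2-adic period tower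
  of the class above the optimal curve» — i.e. `μ(ϖ₀·L₂(f,α)) ≤ t(E₀)` with `ϖ₀ = Ω⁺_f/Ω(E₀)` a 2-adic unit (Abbes–Ullmo), the
  form in which the MODULAR SYMBOLS of `f` are normalised and in which card #8's pieces S2 (MSD flatness to depth `t+1`), S3
  (flat ⇒ Eisenstein, proved mod the span residual) and S4 (Eisenstein ⇒ period descent) are stated:
  `stubAtMaxPeriod_of_optimalTowerBound` (⇐, uses `exists_isNewformOf`) and `optimalTowerBound_of_stubAtMaxPeriod` (⇒).
  The census law «`μ_f = t(E₀)`» of the ideators (373/373 classes N ≤ 4000, kit j310122) is the conjunction of this bound with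
  its (easy) converse inequality.

References: J. S. Milne, *Arithmetic Duality Theorems*, I.7; R. Greenberg, LNM 1716 (1999), §5; G. Stevens, Invent. Math. 98
(1989) (the minimal / maximal-period curve of a class); V. Vatsal, J. Inst. Math. Jussieu 4 (2005), Thm. 1.3.
-/

set_option autoImplicit false
-- the sub-problem namespace repeats the summit name by design (D-0017 nested layout)
set_option linter.dupNamespace false

noncomputable section

open scoped Classical MatrixGroups ModularForm

open CongruenceSubgroup WeierstrassCurve Literature.NumberTheory.EllipticCurves
  Literature.NumberTheory.EllipticCurves.ModularForms Literature.NumberTheory.EllipticCurves.Rank1Residual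
  Literature.NumberTheory.EllipticCurves.Greenberg1999
  Summit.BirchSwinnertonDyer.Rank1Residual.X1.MuPart
  Summit.BirchSwinnertonDyer.Rank1Residual
  Summit.BirchSwinnertonDyer.BirchSwinnertonDyer.Theorems.IsogenyMuShift

namespace Summit.BirchSwinnertonDyer.BirchSwinnertonDyer.Theorems.KatoFreeSandwich

/-! ## §1 Rationality of the period ratio in a class (Milne, unconditional) -/

section Ratio

variable [Algebra (AlgebraicClosure ℚ) ℂ] [IsScalarTower ℚ (AlgebraicClosure ℚ) ℂ]
variable {W W' : WeierstrassCurve ℚ} [W.IsElliptic] [W'.IsElliptic]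

/-- Auxiliary form of `exists_rat_pos_realPeriodRat_eq_mul_of_isIsogenous` with a chosen embedding `ℚ̄ → ℂ`.
[cite: MilneADT2006, Ch. I §7, proof of Thm. 7.3, p. 98] -/
theorem exists_rat_pos_realPeriodRat_eq_mul_of_isogeny_aux (ψ : Isogeny W W') :
    ∃ q : ℚ, 0 < q ∧ W'.realPeriodRat = (q : ℝ) * W.realPeriodRat := by
  haveI hWℝ : (W.baseChange ℝ).IsElliptic := by rw [WeierstrassCurve.baseChange]; infer_instance
  haveI hWℝ' : (W'.baseChange ℝ).IsElliptic := by rw [WeierstrassCurve.baseChange]; infer_instance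
  obtain ⟨k, -, hperiod, -⟩ := ψ.exists_algebraMap_card_ker_inf_realPoints_mul_realPeriod_eq
  -- the real points in the kernel form a finite subgroup containing `O`
  set K := (ψ.baseChange (M := ℂ)).ker ⊓
      (Affine.Point.map (W' := W) (IsScalarTower.toAlgHom ℚ ℝ ℂ)).range with hK
  have hfin : (K : Set (W.baseChange ℂ).toAffine.Point).Finite := by
    have h1 : (((ψ.baseChange (M := ℂ)).ker : AddSubgroup (W.baseChange ℂ).toAffine.Point) :
        Set (W.baseChange ℂ).toAffine.Point).Finite := by
      rw [ψ.ker_baseChange_eq_map, AddSubgroup.coe_map]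
      exact ψ.finite_ker.image _
    exact h1.subset (fun x hx => (AddSubgroup.mem_inf.mp hx).1)
  haveI : Finite K := hfin.to_subtype
  have hcard : 0 < Nat.card K := Nat.card_pos
  set I := ((Affine.Point.map (W' := W) (IsScalarTower.toAlgHom ℚ ℝ ℂ)).range.map
            (ψ.baseChange (M := ℂ))).relIndex
            (Affine.Point.map (W' := W') (IsScalarTower.toAlgHom ℚ ℝ ℂ)).range with hI
  have hΩ : 0 < W.realPeriodRat := W.realPeriodRat_pos_holds
  have hΩ' : 0 < W'.realPeriodRat := W'.realPeriodRat_pos_holds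
  have h : (Nat.card K : ℝ) * W'.realPeriodRat = (I : ℝ) * |(k : ℝ)| * W.realPeriodRat := by
    have := hperiod
    rwa [eq_ratCast] at this
  refine ⟨(I : ℚ) * |k| / (Nat.card K : ℚ), ?_, ?_⟩
  · have hpos : 0 < (I : ℝ) * |(k : ℝ)| := by
      have h1 : 0 < (Nat.card K : ℝ) * W'.realPeriodRat := mul_pos (by exact_mod_cast hcard) hΩ'
      rw [h] at h1
      exact (mul_pos_iff_of_pos_right hΩ).mp h1
    have : (0 : ℝ) < ((I : ℚ) * |k| / (Nat.card K : ℚ) : ℚ) := by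
      push_cast
      exact div_pos hpos (by exact_mod_cast hcard)
    exact_mod_cast this
  · have hK0 : (Nat.card K : ℝ) ≠ 0 := by exact_mod_cast hcard.ne'
    push_cast
    field_simp
    linarith [h]

end Ratio

/-- **The real periods of two ℚ-isogenous elliptic curves differ by a POSITIVE RATIONAL factor** (any models):
`W ∼ W'` ⇒ `Ω(W') = q·Ω(W)`, `q ∈ ℚ_{>0}` — Milne's archimedean isogeny factor with its ℚ-rational multiplier; no modularity.
[cite: MilneADT2006, Ch. I §7, proof of Thm. 7.3, p. 98] -/
theorem exists_rat_pos_realPeriodRat_eq_mul_of_isIsogenous {W W' : WeierstrassCurve ℚ} [W.IsElliptic] [W'.IsElliptic]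
    (h : IsIsogenous W W') : ∃ q : ℚ, 0 < q ∧ W'.realPeriodRat = (q : ℝ) * W.realPeriodRat := by
  haveI hQbar : Algebra.IsAlgebraic ℚ (AlgebraicClosure ℚ) := AlgebraicClosure.isAlgebraic ℚ
  letI : Algebra (AlgebraicClosure ℚ) ℂ :=
    (IsAlgClosed.lift : AlgebraicClosure ℚ →ₐ[ℚ] ℂ).toRingHom.toAlgebra
  haveI : IsScalarTower ℚ (AlgebraicClosure ℚ) ℂ :=
    IsScalarTower.of_algebraMap_eq' (Subsingleton.elim _ _)
  obtain ⟨ψ⟩ := h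
  exact exists_rat_pos_realPeriodRat_eq_mul_of_isogeny_aux ψ

/-! ## §2 The general `μ`-transport of the certificate -/

section Transport

variable {W W' : WeierstrassCurve ℚ} [W.IsElliptic] [W.IsGloballyMinimal] [W'.IsElliptic] [W'.IsGloballyMinimal]

/-- `‖r‖₂ = 2^{-v₂ r}` as a real number, for `r ≠ 0`. [folklore] -/
theorem norm_ratCast_padic_eq_two_zpow {r : ℚ} (hr : r ≠ 0) :
    ‖(r : ℚ_[2])‖ = (2 : ℝ) ^ (-padicValRat 2 r) := by
  haveI : Fact (Nat.Prime 2) := ⟨Nat.prime_two⟩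
  rw [Padic.eq_padicNorm, padicNorm.eq_zpow_of_nonzero hr]
  push_cast
  rfl

/-- **General `μ`-transport.**  `W ∼ W'` globally minimal, good ordinary at `2`, `Ω(W') = r·Ω(W)` and `m ≤ m' + v₂(r)`:
`AnalyticMuLE W 2 m → AnalyticMuLE W' 2 m'`.  (Same newform at the common conductor, same unit root; `ϖ = r·ϖ'`; a
coefficient of `ϖ·L₂` of norm `> 2^{-(m+1)}` is `r` times the corresponding coefficient of `ϖ'·L₂`, whose norm is therefore
`> 2^{v₂ r - (m+1)} ≥ 2^{-(m'+1)}`.) [cite: GreenbergLNM1716, §5 p. 121 (μ and the period along an isogeny; shape)] -/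
theorem analyticMuLE_two_of_isIsogenous_of_le (hgo : GoodOrd W 2) (hiso : IsIsogenous W W') {r : ℚ}
    (hr : W'.realPeriodRat = (r : ℝ) * W.realPeriodRat) {m m' : ℕ} (hle : (m : ℤ) ≤ m' + padicValRat 2 r)
    (hA : AnalyticMuLE W 2 m) : AnalyticMuLE W' 2 m' := by
  intro _ f hf ϖ hϖ
  haveI : Fact (Nat.Prime 2) := ⟨Nat.prime_two⟩
  have hr0 : r ≠ 0 := by
    rintro rfl
    rw [Rat.cast_zero, zero_mul] at hr
    exact (W'.realPeriodRat_pos_holds).ne' hr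
  have hN : W.conductorNorm ℤ = W'.conductorNorm ℤ :=
    conductorNorm_eq_of_isIsogenous_of_hasGoodReductionAtPrime_two hiso hgo.1
  have key : ∀ (N : ℕ) [NeZero N] (g : CuspForm (Gamma0 N) 2), N = W.conductorNorm ℤ → IsNewformOf W g →
      ∀ ϖ₁ : ℚ, (ϖ₁ : ℝ) * W.realPeriodRat = plusPeriod g →
      ∃ n : ℕ, (2 : ℝ) ^ (-((m : ℕ) + 1 : ℤ)) <
        ‖PowerSeries.coeff n (PowerSeries.C (ϖ₁ : ℚ_[2]) * padicLFunction g (unitRoot W 2 : ℚ_[2]))‖ := by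
    intro N _ g hN' hg ϖ₁ hϖ₁
    subst hN'
    exact hA g hg ϖ₁ hϖ₁
  have hfW : IsNewformOf W f := hf.of_isIsogenous hiso
  have hϖW : ((ϖ * r : ℚ) : ℝ) * W.realPeriodRat = plusPeriod f := by
    rw [← hϖ, hr]; push_cast; ring
  obtain ⟨n, hn⟩ := key (W'.conductorNorm ℤ) f hN.symm hfW (ϖ * r) hϖW
  refine ⟨n, ?_⟩
  rw [unitRoot_eq_of_isIsogenous hiso hgo]
  rw [PowerSeries.coeff_C_mul] at hn ⊢
  have hsplit : ((ϖ * r : ℚ) : ℚ_[2]) * PowerSeries.coeff n (padicLFunction f (unitRoot W 2 : ℚ_[2])) =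
      (r : ℚ_[2]) * ((ϖ : ℚ_[2]) * PowerSeries.coeff n (padicLFunction f (unitRoot W 2 : ℚ_[2]))) := by
    push_cast; ring
  rw [hsplit, norm_mul, norm_ratCast_padic_eq_two_zpow hr0] at hn
  -- `2^{-(m+1)} < 2^{-v}·X` ⇒ `2^{v-(m+1)} < X`, and `2^{-(m'+1)} ≤ 2^{v-(m+1)}` since `m ≤ m' + v`
  set X := ‖(ϖ : ℚ_[2]) * PowerSeries.coeff n (padicLFunction f (unitRoot W 2 : ℚ_[2]))‖ with hX
  have hvpos : (0 : ℝ) < (2 : ℝ) ^ (padicValRat 2 r) := zpow_pos (by norm_num) _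
  have hX' : (2 : ℝ) ^ (padicValRat 2 r + -((m : ℕ) + 1 : ℤ)) < X := by
    have h1 := mul_lt_mul_of_pos_left hn hvpos
    rwa [← mul_assoc, ← zpow_add₀ (by norm_num : (2 : ℝ) ≠ 0), ← zpow_add₀ (by norm_num : (2 : ℝ) ≠ 0),
      add_neg_cancel, zpow_zero, one_mul] at h1
  refine lt_of_le_of_lt ?_ hX'
  exact zpow_le_zpow_right₀ (by norm_num) (by omega)

end Transport

/-! ## §3 The research stub of skeleton v5, re-centred at the optimal curve -/

section Optimal

/-- **⇐: the TOWER-HEIGHT BOUND at the optimal curve implies the registered stub `stub_analyticMuLEAtMaxPeriod` (its body,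
with the two print binders PUB / AU it displays left idle).**  Hypothesis `H`: for every globally minimal `X₀(N)`-optimal
`E₀` (a lattice-optimal parametrisation datum at level `N_{E₀}`), non-CM, analytic rank `0`, good ordinary at `2`, whose class
contains a globally minimal member with a rational point of order `2`, and every max-period member `W″ ∼ E₀` with
`Ω(W″) = r·Ω(E₀)`: `AnalyticMuLE E₀ 2 ⌊v₂ r⌋₊`.  Conclusion: `AnalyticMuLE W″ 2 0` at the max-period member of the class of
any non-CM rank-`0` good-ordinary `W` with rational `2`-torsion.  Uses modularity as `exists_isNewformOf` (optimal member:
`X12.exists_isIsogenous_optimal`), §1 (the ratio `r` exists) and §2 (transport down the tower, `v₂ r ≥ 0` by maximality).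
[cite: GreenbergLNM1716, §5 p. 179 (shape: μ and the isogeny class)] -/
theorem stubAtMaxPeriod_of_optimalTowerBound (hnf : exists_isNewformOf)
    (H : ∀ (E₀ : WeierstrassCurve ℚ) [E₀.IsElliptic] [E₀.IsGloballyMinimal] [NeZero (E₀.conductorNorm ℤ)]
      (D₀ : ModularParametrizationData E₀ (E₀.conductorNorm ℤ)),
      (∀ z ∈ D₀.L.lattice, ∃ w ∈ periodLattice D₀.f, z = D₀.c * w) →
      ¬ E₀.HasCM → E₀.analyticRank = 0 → GoodOrd E₀ 2 →
      (∃ (W₁ : WeierstrassCurve ℚ) (_ : W₁.IsElliptic) (_ : W₁.IsGloballyMinimal),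
        IsIsogenous E₀ W₁ ∧ ∃ x : ℚ, HasRationalTwoTorsionX W₁ x) →
      ∀ (W'' : WeierstrassCurve ℚ) [W''.IsElliptic] [W''.IsGloballyMinimal], IsIsogenous E₀ W'' →
      (∀ (W₃ : WeierstrassCurve ℚ) [W₃.IsElliptic] [W₃.IsGloballyMinimal], IsIsogenous W'' W₃ →
        ∀ q : ℚ, W₃.realPeriodRat = (q : ℝ) * W''.realPeriodRat → padicValRat 2 q ≤ 0) →
      ∀ r : ℚ, W''.realPeriodRat = (r : ℝ) * E₀.realPeriodRat → AnalyticMuLE E₀ 2 (padicValRat 2 r).toNat) :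
    ∀ (W W'' : WeierstrassCurve ℚ) [W.IsElliptic] [W.IsGloballyMinimal] [W''.IsElliptic] [W''.IsGloballyMinimal],
      ¬ W.HasCM → W.analyticRank = 0 → GoodOrd W 2 → IsIsogenous W W'' →
      (∃ x : ℚ, HasRationalTwoTorsionX W x) →
      (∀ (W₃ : WeierstrassCurve ℚ) [W₃.IsElliptic] [W₃.IsGloballyMinimal], IsIsogenous W'' W₃ →
        ∀ q : ℚ, W₃.realPeriodRat = (q : ℝ) * W''.realPeriodRat → padicValRat 2 q ≤ 0) →
      AnalyticMuLE W'' 2 0 := by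
  intro W W'' _ _ _ _ hcm hr hgo hiso h2 hmax
  haveI : Fact (Nat.Prime 2) := ⟨Nat.prime_two⟩
  obtain ⟨E₀, hE₀, hM₀, hNZ, D₀, hiso₀, -, hopt⟩ := X12.exists_isIsogenous_optimal hnf W
  -- the guards move to `E₀`
  have hcm₀ : ¬ E₀.HasCM := fun h => hcm ((X12.hasCM_iff_of_isIsogenous hiso₀).mpr h)
  have hr₀ : E₀.analyticRank = 0 := by rw [← analyticRank_eq_of_isIsogenous' hiso₀]; exact hr
  have hgo₀ : GoodOrd E₀ 2 := isOrdinaryAt_of_isIsogenous hiso₀ hgo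
  have hiso₀'' : IsIsogenous E₀ W'' := (hiso₀.symm_of_charZero).trans' hiso
  -- the ratio `Ω(W″) = r·Ω(E₀)` and its valuation `t ≥ 0`
  obtain ⟨r, hrpos, hrΩ⟩ := exists_rat_pos_realPeriodRat_eq_mul_of_isIsogenous hiso₀''
  have hr0 : r ≠ 0 := hrpos.ne'
  have hrΩ' : E₀.realPeriodRat = ((r⁻¹ : ℚ) : ℝ) * W''.realPeriodRat := by
    rw [hrΩ, Rat.cast_inv, ← mul_assoc, inv_mul_cancel₀ (by exact_mod_cast hr0), one_mul]
  have ht : 0 ≤ padicValRat 2 r := by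
    have := hmax E₀ hiso₀''.symm_of_charZero r⁻¹ hrΩ'
    rwa [padicValRat.inv, neg_nonpos] at this
  have hA₀ : AnalyticMuLE E₀ 2 (padicValRat 2 r).toNat :=
    H E₀ D₀ hopt hcm₀ hr₀ hgo₀ ⟨W, ‹_›, ‹_›, hiso₀.symm_of_charZero, h2⟩ W'' hiso₀'' hmax r hrΩ
  intro _ f hf ϖ hϖ
  exact analyticMuLE_two_of_isIsogenous_of_le hgo₀ hiso₀'' hrΩ
    (m := (padicValRat 2 r).toNat) (m' := 0) (by rw [Int.toNat_of_nonneg ht]; push_cast; omega) hA₀ f hf ϖ hϖ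

/-- **⇒: the registered stub implies the tower-height bound at the optimal curve** (no modularity needed in this direction:
the optimal curve is just a member).  With the previous theorem: granted `exists_isNewformOf`, the research stub of the line
and the bound «`μ(ϖ₀·L₂) ≤ t(E₀)` at every optimal rank-`0` good-ordinary non-CM `E₀` with a reducible class member» are
EQUIVALENT. [cite: GreenbergLNM1716, §5 p. 179 (shape)] -/
theorem optimalTowerBound_of_stubAtMaxPeriod
    (hS : ∀ (W W'' : WeierstrassCurve ℚ) [W.IsElliptic] [W.IsGloballyMinimal] [W''.IsElliptic] [W''.IsGloballyMinimal],
      ¬ W.HasCM → W.analyticRank = 0 → GoodOrd W 2 → IsIsogenous W W'' →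
      (∃ x : ℚ, HasRationalTwoTorsionX W x) →
      (∀ (W₃ : WeierstrassCurve ℚ) [W₃.IsElliptic] [W₃.IsGloballyMinimal], IsIsogenous W'' W₃ →
        ∀ q : ℚ, W₃.realPeriodRat = (q : ℝ) * W''.realPeriodRat → padicValRat 2 q ≤ 0) →
      AnalyticMuLE W'' 2 0) :
    ∀ (E₀ : WeierstrassCurve ℚ) [E₀.IsElliptic] [E₀.IsGloballyMinimal] [NeZero (E₀.conductorNorm ℤ)]
      (D₀ : ModularParametrizationData E₀ (E₀.conductorNorm ℤ)),
      (∀ z ∈ D₀.L.lattice, ∃ w ∈ periodLattice D₀.f, z = D₀.c * w) →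
      ¬ E₀.HasCM → E₀.analyticRank = 0 → GoodOrd E₀ 2 →
      (∃ (W₁ : WeierstrassCurve ℚ) (_ : W₁.IsElliptic) (_ : W₁.IsGloballyMinimal),
        IsIsogenous E₀ W₁ ∧ ∃ x : ℚ, HasRationalTwoTorsionX W₁ x) →
      ∀ (W'' : WeierstrassCurve ℚ) [W''.IsElliptic] [W''.IsGloballyMinimal], IsIsogenous E₀ W'' →
      (∀ (W₃ : WeierstrassCurve ℚ) [W₃.IsElliptic] [W₃.IsGloballyMinimal], IsIsogenous W'' W₃ →
        ∀ q : ℚ, W₃.realPeriodRat = (q : ℝ) * W''.realPeriodRat → padicValRat 2 q ≤ 0) →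
      ∀ r : ℚ, W''.realPeriodRat = (r : ℝ) * E₀.realPeriodRat → AnalyticMuLE E₀ 2 (padicValRat 2 r).toNat := by
  intro E₀ _ _ _ D₀ _ hcm₀ hr₀ hgo₀ hW₁ W'' _ _ hiso₀'' hmax r hrΩ
  haveI : Fact (Nat.Prime 2) := ⟨Nat.prime_two⟩
  obtain ⟨W₁, hE₁, hM₁, hiso₁, h2⟩ := hW₁
  have hcm₁ : ¬ W₁.HasCM := fun h => hcm₀ ((X12.hasCM_iff_of_isIsogenous hiso₁).mpr h)
  have hr₁ : W₁.analyticRank = 0 := by rw [← analyticRank_eq_of_isIsogenous' hiso₁]; exact hr₀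
  have hgo₁ : GoodOrd W₁ 2 := isOrdinaryAt_of_isIsogenous hiso₁ hgo₀
  have hA'' : AnalyticMuLE W'' 2 0 :=
    hS W₁ W'' hcm₁ hr₁ hgo₁ ((hiso₁.symm_of_charZero).trans' hiso₀'') h2 hmax
  have hr0 : r ≠ 0 := by
    rintro rfl
    rw [Rat.cast_zero, zero_mul] at hrΩ
    exact (W''.realPeriodRat_pos_holds).ne' hrΩ
  have hrΩ' : E₀.realPeriodRat = ((r⁻¹ : ℚ) : ℝ) * W''.realPeriodRat := by
    rw [hrΩ, Rat.cast_inv, ← mul_assoc, inv_mul_cancel₀ (by exact_mod_cast hr0), one_mul]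
  have hgo'' : GoodOrd W'' 2 := isOrdinaryAt_of_isIsogenous hiso₀'' hgo₀
  intro _ f hf ϖ hϖ
  refine analyticMuLE_two_of_isIsogenous_of_le hgo'' hiso₀''.symm_of_charZero hrΩ' (m := 0)
    (m' := (padicValRat 2 r).toNat) ?_ hA'' f hf ϖ hϖ
  rw [padicValRat.inv]
  push_cast
  have := Int.self_le_toNat (padicValRat 2 r)
  omega

end Optimal

end Summit.BirchSwinnertonDyer.BirchSwinnertonDyer.Theorems.KatoFreeSandwich

end
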